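import Summits.BirchSwinnertonDyer.BirchSwinnertonDyer.Theses.KatoDescentPotSupersingular
import Summits.BirchSwinnertonDyer.Rank1Residual.O6.X3WildOfKMCTorsionFreeMember
import Summits.BirchSwinnertonDyer.Rank1Residual.Additive.KMCTrivialDescentRankZero
import Summits.BirchSwinnertonDyer.Rank1Residual.Additive.FouquetWanLocus
import Summits.BirchSwinnertonDyer.Rank1Residual.Additive.QuadraticTwistBSDComparisonIsogeny
import Summits.BirchSwinnertonDyer.Rank1Residual.Additive.N10LowerHalfStatements
import HarnessLib

/-!
# Route `KatoDescentPotSupersingular` (rung K9, cell `bsd-potss`): the crux `WildLowerHalfRankZero`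
# (L₀, item stmt-BirchSwinnertonDyer-19195) — WHAT IT IS, by kernel theorems (a `--supports` file)

The crux is `∀ W` globally minimal, `r_an = 0`, `ClassO6 W 3` (additive, potentially supersingular,
WILD at `3`): `MissingLowerBoundAt W 3`, i.e. `ord₃ #Ш_an(E) ≤ ord₃ #Ш(E)` — the "main-conjecture"
half of `BSD(E,3)`. This file records, as theorems over DISPLAYED named facts / reading schemata (every
conjectural or announced input is a hypothesis; nothing is credited, the item is NOT closed):

* §1 the lower half TRANSPORTS along `ℚ`-isogenies in analytic rank `≤ 1` (Cassels' invariance of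
  the BSD quotient `hCassels` + GZK + modularity: the defect `ord_p #Ш − ord_p #Ш_an` is a class
  invariant — the tree's `TwistComparison.missingLowerBoundAt_of_isIsogenous`), hence (i) **L₀ holds on every wild class one of whose members has `3 ∤ #Ш_an`**
  (unconditional over Cassels/GZK/modularity — the bulk of the census rows), and (ii) **the crux
  REDUCES to the `3`-torsion-free additive potentially good rank-`0` rows** (Mazur–Kenku gives the
  member; `Addv.exists_torsionFree_member`), where Kato's `H⁰` terms vanish;
* §2 the DescentGlue in ROUTE currency: Kato's Main Conjecture 12.10 at `p = 3` (interface `KMC`,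
  definition request D-O6-2 `defn-KatoMainConjecture`) at the `3`-torsion-free wild members, over the
  image-free readings 1♭/3♭ of `Additive/KatoDescentTorsionFreeReadings.lean` and the interface
  lemma, gives the crux BY NAME (`O6.wildLowerHalfRankZero_of_kmc_torsionFree`, kmc part 10);
* §3 the CONVERSE on Kato's (12.5.2) rows: over readings 1/2/3 of `Additive/KatoDescentDatum.lean`
  the crux IMPLIES `KMC W 3` for every wild rank-`0` curve whose `3`-adic tower image contains
  `SL₂(ℤ₃)` (`Additive.kmc_of_missingLowerBoundAt_of_readings`, kmc part 2) — so on that sub-class the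
  crux is EXACTLY Kato's Conjecture 12.10 for `(f_E, 3)` (an open problem in print: no lower
  divisibility of a main conjecture is proved at an additive prime), which is the kernel form of the
  route's label "difficulty: open-problem";
* §4 the FOUQUET–WAN LOCUS of the registered stub `stub_lower_irred`: on `X4 ∧ LocIrr ∧ FWNonsplitRam`
  (`E[3]` irreducible, `E[3]|G_{ℚ₃}` irreducible, a non-split multiplicative `q ≠ 3` with `E[3]`
  ramified) Kato's main conjecture is CLAIMED by arXiv:2107.13726 Thm. 5.1 (PRE; hypothesis shape
  `FouquetWanClaimShape KMC` of `Additive/FouquetWanLocus.lean`); there `E` is its own torsion-free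
  member and the readings give L₀ with no Mazur–Kenku and no Cassels.

Everything off these rows — `E[3]|G_{ℚ₃}` reducible (the common case at a wild `3`), no non-split
ramified Steinberg prime, or `E[3]` reducible (X3-wild), at a class ALL of whose members have
`3 ∣ #Ш_an` — is the open content of the item: Kato's Conj. 12.10 at `3` with nothing announced.
Seat `bsd-potss-k9-c2` (prover), generation 0.

References: [Kato2004Asterisque] Conj. 12.10 (p. 224), Thm. 12.5 (4) (p. 222), §14.14 (p. 243), Prop.
14.16 (2) (p. 244); [Cassels1965ArithmeticVIII]; [MilneADT2006] Thm. I.7.3; [Miller2011LMS] Def. 1.1;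
[FouquetWan2021] Thm. 5.1 / 1.7; [SilvermanAEC2009] IX.6 Ex. 6.4 (Mazur–Kenku).
-/

set_option autoImplicit false
-- sibling precedent (`KatoDescentPotSupersingularAssembly.lean`): the directory name repeats the summit name
set_option linter.dupNamespace false

noncomputable section

open scoped Classical

namespace Summit.BirchSwinnertonDyer.BirchSwinnertonDyer.Theorems

open WeierstrassCurve Literature.NumberTheory.EllipticCurves
  Literature.NumberTheory.EllipticCurves.ModularForms
  Literature.NumberTheory.EllipticCurves.Rank1Residual
  Literature.NumberTheory.EllipticCurves.Rank1Residual.Typed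
  Summit.BirchSwinnertonDyer.Rank1Residual.Additive
  Summit.BirchSwinnertonDyer.Rank1Residual
  Summit.BirchSwinnertonDyer.BirchSwinnertonDyer.Theses.KatoDescentPotSupersingular

/-! ## §1 The lower half along the isogeny class (Cassels), the unit rows, and the reduction of the crux
to torsion-free members -/

section Cassels

/-- **L₀ on every wild class with a `3`-adic-unit member** (unconditional over Cassels `hCassels`, GZK
`hGZK`, modularity `hmod`): for `W` globally minimal of analytic rank `0` in `ClassO6 W 3`, if SOME
globally minimal `W' ∼_ℚ W` has `#Ш_an(W') = q'` with `ord₃ q' ≤ 0`, then `MissingLowerBoundAt W 3`.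
On an X3-wild class whose `#Ш_an`-minimal member is a `3`-adic unit this settles every member (the
`3`-power part of `#Ш_an` created along `3`-isogenies is matched by Cassels' transport of `#Ш`); the
open rows of the crux are the classes ALL of whose members have `3 ∣ #Ш_an`.
[cite: MilneADT2006, Thm. I.7.3] [cite: Darmon2004, Thm. 3.22] [cite: Miller2011LMS, Def. 1.1] -/
theorem missingLowerBoundAt_wild_of_isIsogenous_unit (hCassels : bsdRHS_eq_of_isIsogenous)
    (hGZK : rank_eq_analyticRank_of_analyticRank_le_one) (hmod : hasEntireLFunction_rat)
    (W : WeierstrassCurve ℚ) [W.IsElliptic] [W.IsGloballyMinimal] [Fact (3 : ℕ).Prime]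
    (hr : W.analyticRank = 0) (_hO : ClassO6 W 3)
    (W' : WeierstrassCurve ℚ) [W'.IsElliptic] [W'.IsGloballyMinimal] (hiso : IsIsogenous W W')
    {q' : ℚ} (hq' : shaAn W' = (q' : ℂ)) (hv' : padicValRat 3 q' ≤ 0) : MissingLowerBoundAt W 3 := by
  have hr' : W'.analyticRank ≤ 1 := by
    rw [← analyticRank_eq_of_isIsogenous' hiso, hr]; exact zero_le_one
  exact TwistComparison.missingLowerBoundAt_of_isIsogenous W' W 3 hCassels hGZK hmod
    hiso.symm_of_charZero hr' (N10.missingLowerBoundAt_of_padicValRat_le_zero W' 3 hq' hv')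

/-- **REDUCTION of the crux to the `3`-torsion-free rows** (unconditional over Cassels, GZK,
modularity and Mazur–Kenku `hMK`): if the lower half holds at every globally minimal `W'` of analytic
rank `0` which is additive and potentially good at `3` with `3 ∤ #W'(ℚ)_tors`, then
`WildLowerHalfRankZero`. (Every wild class has such a member, `Addv.exists_torsionFree_member`; then
the isogeny transport of the lower half, `TwistComparison.missingLowerBoundAt_of_isIsogenous`.) This is the member at which Kato's descent runs image-free (parts 8a/8b/10 of the kmc
files): the `H⁰` factors of Prop. 14.16 and Greenberg's cokernel vanish there.
[cite: SilvermanAEC2009, IX.6 Example 6.4] [cite: Mazur1977, Ch. III §5, (5.4)] [cite: MilneADT2006, Thm. I.7.3] -/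
theorem wildLowerHalfRankZero_of_torsionFree_rows (hCassels : bsdRHS_eq_of_isIsogenous)
    (hGZK : rank_eq_analyticRank_of_analyticRank_le_one) (hmod : hasEntireLFunction_rat)
    (hMK : mazurKenku_exists_cyclic_isogeny)
    (h : ∀ (W' : WeierstrassCurve ℚ) [W'.IsElliptic] [W'.IsGloballyMinimal],
      W'.analyticRank = 0 → Addv W' 3 → 0 ≤ padicValRat 3 W'.j → ¬ 3 ∣ W'.torsionOrder →
        MissingLowerBoundAt W' 3) :
    WildLowerHalfRankZero := by
  intro W _ _ _ hr hO
  obtain ⟨W', hW', hM', hiso, hadd', hj', ht'⟩ :=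
    Addv.exists_torsionFree_member hMK hO.1 hO.2.1 hO.padicValRat_j_nonneg
  haveI := hW'
  haveI := hM'
  have hr' : W'.analyticRank = 0 := by rw [← analyticRank_eq_of_isIsogenous' hiso, hr]
  exact TwistComparison.missingLowerBoundAt_of_isIsogenous W' W 3 hCassels hGZK hmod
    hiso.symm_of_charZero (by rw [hr']; exact zero_le_one) (h W' hr' hadd' hj' ht')

end Cassels

/-! ## §2 The DescentGlue in route currency: KMC₃ at the torsion-free wild members ⟹ the crux BY NAME -/

section DescentGlue

variable {IsOf : ∀ (W : WeierstrassCurve ℚ) [W.IsElliptic] [W.IsGloballyMinimal] (p : ℕ) [Fact p.Prime],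
  KatoDescentDatum p → Prop}
variable {KMC : ∀ (W : WeierstrassCurve ℚ) [W.IsElliptic] [W.IsGloballyMinimal] (p : ℕ), Prop}

/-- **`WildLowerHalfRankZero` FOLLOWS from Kato's Main Conjecture 12.10 at `p = 3` at the
`3`-torsion-free wild curves** — the route's two-layer split `KMCThree → DescentGlue → L₀` with the
glue PROVED (kmc part 10, `O6.wildLowerHalfRankZero_of_kmc_torsionFree`), here concluding the ROUTE
DECL by name. Displayed inputs: the image-free readings 1♭ (`TorsionFree.DescentCountReading`: Kato
Prop. 14.16 (2) + Lemma T + local index + period) and 3♭ (`TorsionFree.RealizableOfKMC`), the interface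
lemma `ReadsTrivialKMC`, Cassels, GZK, modularity, Mazur–Kenku, and KMC₃ itself (`hK`, the interface
`KMC` of D-O6-2 `defn-KatoMainConjecture`). Conditional; nothing credited.
[cite: Kato2004Asterisque, Conj. 12.10 (p. 224), §14.14 (p. 243), Prop. 14.16 (2) (p. 244)] [cite: Cassels1965ArithmeticVIII] -/
theorem wildLowerHalfRankZero_of_kmcThree_torsionFree (hR : TorsionFree.DescentCountReading IsOf)
    (hreal : TorsionFree.RealizableOfKMC IsOf KMC) (hread : ReadsTrivialKMC IsOf KMC)
    (hCassels : bsdRHS_eq_of_isIsogenous) (hGZK : rank_eq_analyticRank_of_analyticRank_le_one)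
    (hmod : hasEntireLFunction_rat) (hMK : mazurKenku_exists_cyclic_isogeny)
    (hK : ∀ (W : WeierstrassCurve ℚ) [W.IsElliptic] [W.IsGloballyMinimal],
      W.analyticRank = 0 → Addv W 3 → 0 ≤ padicValRat 3 W.j → ¬ 3 ∣ W.torsionOrder → KMC W 3) :
    WildLowerHalfRankZero := by
  intro W _ _ _ hr hO
  exact O6.wildLowerHalfRankZero_of_kmc_torsionFree hR hreal hread hCassels hGZK hmod hMK hK W hr hO

/-- **The same glue through §1's reduction** (KMC₃ used only AT the torsion-free rows, where
`TorsionFree.missingPPartAt_rankZero_of_kmc` gives `BSD₃`'s `p`-part directly): a second derivation,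
recorded because it separates the two inputs of the crux — the class transport (published) and the
descent (conjectural). [cite: Kato2004Asterisque, Conj. 12.10 (p. 224), Prop. 14.16 (2) (p. 244)] -/
theorem wildLowerHalfRankZero_of_kmcThree_torsionFree' (hR : TorsionFree.DescentCountReading IsOf)
    (hreal : TorsionFree.RealizableOfKMC IsOf KMC) (hread : ReadsTrivialKMC IsOf KMC)
    (hCassels : bsdRHS_eq_of_isIsogenous) (hGZK : rank_eq_analyticRank_of_analyticRank_le_one)
    (hmod : hasEntireLFunction_rat) (hMK : mazurKenku_exists_cyclic_isogeny)
    (hK : ∀ (W : WeierstrassCurve ℚ) [W.IsElliptic] [W.IsGloballyMinimal],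
      W.analyticRank = 0 → Addv W 3 → 0 ≤ padicValRat 3 W.j → ¬ 3 ∣ W.torsionOrder → KMC W 3) :
    WildLowerHalfRankZero :=
  wildLowerHalfRankZero_of_torsionFree_rows hCassels hGZK hmod hMK fun W' _ _ hr' hadd' hj' ht' ↦
    (lower_and_upper_of_missingPPartAt W' 3 (TorsionFree.missingPPartAt_rankZero_of_kmc W' 3 hR hreal
      hread hGZK hmod hr' (by decide) hadd' hj' ht' (hK W' hr' hadd' hj' ht'))).1

end DescentGlue

/-! ## §3 The converse on Kato's (12.5.2) rows: there the crux IS Kato's Conjecture 12.10 at `3` -/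

section Converse

variable {IsOf : ∀ (W : WeierstrassCurve ℚ) [W.IsElliptic] [W.IsGloballyMinimal] (p : ℕ) [Fact p.Prime],
  KatoDescentDatum p → Prop}
variable {KMC : ∀ (W : WeierstrassCurve ℚ) [W.IsElliptic] [W.IsGloballyMinimal] (p : ℕ), Prop}

/-- **The crux IMPLIES Kato's Main Conjecture at `3` on every wild rank-`0` curve with (12.5.2)**
(`ρ_{E,3^∞}(G_{ℚ(ζ_{3^∞})}) ⊇ SL₂(ℤ₃)`), over the readings of Kato's PRINTED theorems — reading 1 (the
count with `μ` kept: Prop. 14.16 (2), Lemma T, local index, period), reading 2 (the divisibility of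
Thm. 12.5 (4)), reading 3 (a datum exists: 8.1, 12.4, 12.5 (4), §14.14) — the interface lemma, GZK and
modularity: the lower half forces `m = 0` in `[H¹(ℤ[1/3],T) : z] = 3^m · #H²(ℤ[1/3],T)`, and with
Kato's divisibility the index equality is Conj. 12.10 (kmc part 2,
`Additive.kmc_of_missingLowerBoundAt_of_readings`). So a proof of the crux is a proof of Kato's
Conjecture 12.10 for `(f_E, 3)` at every such curve — an infinite family on which no main conjecture
is proved or announced beyond the Fouquet–Wan locus of §4.
[cite: Kato2004Asterisque, Conj. 12.10 (p. 224), Thm. 12.5 (4) (p. 222), §14.14 (p. 243), Prop. 14.16 (2) (p. 244)] -/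
theorem kmcThree_of_wildLowerHalfRankZero (hR : Additive.DescentCountReading IsOf)
    (hdiv : DivisibilityReading IsOf) (hreal : Realizable IsOf) (hread : ReadsTrivialKMC IsOf KMC)
    (hGZK : rank_eq_analyticRank_of_analyticRank_le_one) (hmod : hasEntireLFunction_rat)
    (h : WildLowerHalfRankZero)
    (W : WeierstrassCurve ℚ) [W.IsElliptic] [W.IsGloballyMinimal] [Fact (3 : ℕ).Prime]
    (hr : W.analyticRank = 0) (hO : ClassO6 W 3) (hK : Kato2004.ImageContainsSL2 W 3) : KMC W 3 :=
  kmc_of_missingLowerBoundAt_of_readings hR hdiv hreal hread hGZK hmod W 3 hr hO.1 hO.2.1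
    hO.padicValRat_j_nonneg hK (h W hr hO)

/-- **On the (12.5.2) rows the crux and KMC₃ are EQUIVALENT** (over readings 1/2/3, the interface
lemma, GZK, modularity): `(∀ wild r0 W with (12.5.2), MissingLowerBoundAt W 3) ↔ (∀ such W, KMC W 3)`.
The kernel form of "WildLowerHalfRankZero is the `T = 0` shadow of Kato's Main Conjecture".
[cite: Kato2004Asterisque, Conj. 12.10 (p. 224), Thm. 12.5 (4) (p. 222), §14.14 (p. 243)] -/
theorem wildLowerHalf_towerSurj_iff_kmcThree (hR : Additive.DescentCountReading IsOf)
    (hdiv : DivisibilityReading IsOf) (hreal : Realizable IsOf) (hread : ReadsTrivialKMC IsOf KMC)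
    (hGZK : rank_eq_analyticRank_of_analyticRank_le_one) (hmod : hasEntireLFunction_rat) :
    (∀ (W : WeierstrassCurve ℚ) [W.IsElliptic] [W.IsGloballyMinimal] [Fact (3 : ℕ).Prime],
        W.analyticRank = 0 → ClassO6 W 3 → Kato2004.ImageContainsSL2 W 3 → MissingLowerBoundAt W 3) ↔
      ∀ (W : WeierstrassCurve ℚ) [W.IsElliptic] [W.IsGloballyMinimal] [Fact (3 : ℕ).Prime],
        W.analyticRank = 0 → ClassO6 W 3 → Kato2004.ImageContainsSL2 W 3 → KMC W 3 := by
  constructor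
  · intro h W _ _ _ hr hO hK
    exact kmc_of_missingLowerBoundAt_of_readings hR hdiv hreal hread hGZK hmod W 3 hr hO.1 hO.2.1
      hO.padicValRat_j_nonneg hK (h W hr hO hK)
  · intro h W _ _ _ hr hO hK
    exact ((kmc_iff_missingLowerBoundAt_of_readings hR hdiv hreal hread hGZK hmod W 3 hr hO.1 hO.2.1
      hO.padicValRat_j_nonneg hK).1).mp (h W hr hO hK)

end Converse

/-! ## §4 The Fouquet–Wan locus of `stub_lower_irred` (announced KMC, PRE; hypothesis shape only) -/

section FouquetWan

variable {IsOf : ∀ (W : WeierstrassCurve ℚ) [W.IsElliptic] [W.IsGloballyMinimal] (p : ℕ) [Fact p.Prime],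
  KatoDescentDatum p → Prop}
variable {KMC : ∀ (W : WeierstrassCurve ℚ) [W.IsElliptic] [W.IsGloballyMinimal] (p : ℕ), Prop}

/-- **L₀ on the Fouquet–Wan rows of the wild class, from the announced claim + the image-free
readings** (no (12.5.2), no Mazur–Kenku, no Cassels): for `W` globally minimal of analytic rank `0` in
`ClassO6 W 3` with `E[3]` irreducible (`Irr W 3`), `E[3]|G_{ℚ₃}` irreducible (`LocIrr W 3`) and a
non-split multiplicative `q ≠ 3` at which `E[3]` is ramified (`FWNonsplitRam W 3`),
`FouquetWanClaimShape KMC` (arXiv:2107.13726 Thm. 5.1 for `f = f_E`, level `Np^r`; PRE, a hypothesis)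
gives `KMC W 3`; `E[3]` irreducible gives `3 ∤ #W(ℚ)_tors`, so `W` is its own torsion-free member and
`TorsionFree.missingPPartAt_rankZero_of_kmc` (readings 1♭/3♭ + interface lemma + GZK + modularity)
gives `BSD₃`'s `p`-part, in particular the lower half. Census of the locus (rmap-2 g8, evidence only):
`2 102 / 21 314` wild X4 rank-`0` cells (`LocIrr` on `3 617`). Nothing credited.
[cite: FouquetWan2021, Thm. 5.1 and Thm. 1.7 (p. 5)] [cite: Kato2004Asterisque, Conj. 12.10 (p. 224), Prop. 14.16 (2) (p. 244)]
[cite: Mazur1977, Ch. III §5, p. 157] -/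
theorem missingLowerBoundAt_wild_of_fwClaim_of_readings (hFW : FouquetWanClaimShape KMC)
    (hR : TorsionFree.DescentCountReading IsOf) (hreal : TorsionFree.RealizableOfKMC IsOf KMC)
    (hread : ReadsTrivialKMC IsOf KMC) (hGZK : rank_eq_analyticRank_of_analyticRank_le_one)
    (hmod : hasEntireLFunction_rat)
    (W : WeierstrassCurve ℚ) [W.IsElliptic] [W.IsGloballyMinimal] [Fact (3 : ℕ).Prime]
    (hr : W.analyticRank = 0) (hO : ClassO6 W 3) (hI : Irr W 3) (hloc : LocIrr W 3)
    (hstb : FWNonsplitRam W 3) : MissingLowerBoundAt W 3 := by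
  have hX : ClassX4 W 3 := ⟨hO.1, hO.2.1, hI⟩
  have ht : ¬ 3 ∣ W.torsionOrder := not_dvd_torsionOrder_of_irr W 3 hI
  exact (lower_and_upper_of_missingPPartAt W 3 (TorsionFree.missingPPartAt_rankZero_of_kmc W 3 hR
    hreal hread hGZK hmod hr (by decide) hO.2.1 hO.padicValRat_j_nonneg ht (hFW W 3 hX hloc hstb))).1

/-- **Both halves on the Fouquet–Wan rows** (same inputs): `MissingPPartAt W 3`, i.e. the `3`-part of
BSD in Miller's currency — the upper half comes with the descent at a torsion-free member, so NO
separate Kato 14.5 (3) / Tamagawa / Manin input is needed on this locus. Nothing credited.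
[cite: FouquetWan2021, Thm. 5.1] [cite: Kato2004Asterisque, Conj. 12.10 (p. 224), Prop. 14.16 (2) (p. 244)] [cite: Miller2011LMS, Def. 1.1] -/
theorem missingPPartAt_wild_of_fwClaim_of_readings (hFW : FouquetWanClaimShape KMC)
    (hR : TorsionFree.DescentCountReading IsOf) (hreal : TorsionFree.RealizableOfKMC IsOf KMC)
    (hread : ReadsTrivialKMC IsOf KMC) (hGZK : rank_eq_analyticRank_of_analyticRank_le_one)
    (hmod : hasEntireLFunction_rat)
    (W : WeierstrassCurve ℚ) [W.IsElliptic] [W.IsGloballyMinimal] [Fact (3 : ℕ).Prime]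
    (hr : W.analyticRank = 0) (hO : ClassO6 W 3) (hI : Irr W 3) (hloc : LocIrr W 3)
    (hstb : FWNonsplitRam W 3) : MissingPPartAt W 3 :=
  TorsionFree.missingPPartAt_rankZero_of_kmc W 3 hR hreal hread hGZK hmod hr (by decide) hO.2.1
    hO.padicValRat_j_nonneg (not_dvd_torsionOrder_of_irr W 3 hI) (hFW W 3 ⟨hO.1, hO.2.1, hI⟩ hloc hstb)

/-- **The registered stub `stub_lower_irred` RESTRICTED to the Fouquet–Wan locus, over the announced
claim and the readings** — the statement `Sig.stub_lower_irred` of the BC3 skeleton with the two extra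
row hypotheses `LocIrr W 3`, `FWNonsplitRam W 3` (so NOT the stub: its complement inside X4-wild,
`E[3]|G_{ℚ₃}` reducible or no non-split ramified Steinberg prime, has no announced main conjecture).
Conditional; nothing credited. [cite: FouquetWan2021, Thm. 5.1] [cite: Kato2004Asterisque, Conj. 12.10 (p. 224)] -/
theorem lower_irred_fwLocus_of_fwClaim_of_readings (hFW : FouquetWanClaimShape KMC)
    (hR : TorsionFree.DescentCountReading IsOf) (hreal : TorsionFree.RealizableOfKMC IsOf KMC)
    (hread : ReadsTrivialKMC IsOf KMC) (hGZK : rank_eq_analyticRank_of_analyticRank_le_one)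
    (hmod : hasEntireLFunction_rat) :
    ∀ (W : WeierstrassCurve ℚ) [W.IsElliptic] [W.IsGloballyMinimal] [Fact (3 : ℕ).Prime],
      W.analyticRank = 0 → ClassO6 W 3 → W.HasIrreducibleModPGaloisRep 3 → LocIrr W 3 →
        FWNonsplitRam W 3 → MissingLowerBoundAt W 3 :=
  fun W _ _ _ hr hO hI hloc hstb ↦
    missingLowerBoundAt_wild_of_fwClaim_of_readings hFW hR hreal hread hGZK hmod W hr hO hI hloc hstb

end FouquetWan

/-! ## §5 The reshaped composition: the crux from the announced claim, the published transports, and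
its two RESIDUAL row-sets displayed as hypotheses -/

section Composition

variable {IsOf : ∀ (W : WeierstrassCurve ℚ) [W.IsElliptic] [W.IsGloballyMinimal] (p : ℕ) [Fact p.Prime],
  KatoDescentDatum p → Prop}
variable {KMC : ∀ (W : WeierstrassCurve ℚ) [W.IsElliptic] [W.IsGloballyMinimal] (p : ℕ), Prop}

/-- **`WildLowerHalfRankZero` from: the Fouquet–Wan claim shape + the image-free readings (§4), Cassels'
transport of the unit members (§1), and the two RESIDUAL row-sets as displayed hypotheses** —
`hX4res`: the irreducible wild rank-`0` rows OFF the Fouquet–Wan locus (`E[3]|G_{ℚ₃}` reducible or no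
non-split ramified Steinberg prime) in a class with NO `3`-adic-unit member; `hX3res`: the reducible
(X3-wild) rank-`0` rows in a class with no `3`-adic-unit member. These two hypotheses ARE the open
content of the item (Kato's Conj. 12.10 at `3` there, §3; nothing announced); everything else is a
named published fact, a reading of Kato's printed theorems, or the PRE claim. For the tenure planner:
the registered split `stub_lower_irred` / `stub_lower_red` refines to (FW locus | X4 residual) /
(X3 residual), each residual further cut by "no unit member". Conditional; the item is NOT closed.
[cite: FouquetWan2021, Thm. 5.1] [cite: Kato2004Asterisque, Conj. 12.10 (p. 224)] [cite: MilneADT2006, Thm. I.7.3]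
[cite: Miller2011LMS, Def. 1.1] -/
theorem wildLowerHalfRankZero_of_fwClaim_of_residualRows (hFW : FouquetWanClaimShape KMC)
    (hR : TorsionFree.DescentCountReading IsOf) (hreal : TorsionFree.RealizableOfKMC IsOf KMC)
    (hread : ReadsTrivialKMC IsOf KMC) (hCassels : bsdRHS_eq_of_isIsogenous)
    (hGZK : rank_eq_analyticRank_of_analyticRank_le_one) (hmod : hasEntireLFunction_rat)
    (hX4res : ∀ (W : WeierstrassCurve ℚ) [W.IsElliptic] [W.IsGloballyMinimal] [Fact (3 : ℕ).Prime],
      W.analyticRank = 0 → ClassO6 W 3 → Irr W 3 → ¬ (LocIrr W 3 ∧ FWNonsplitRam W 3) →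
      (∀ (W' : WeierstrassCurve ℚ) [W'.IsElliptic] [W'.IsGloballyMinimal], IsIsogenous W W' →
        ∀ q' : ℚ, shaAn W' = (q' : ℂ) → 0 < padicValRat 3 q') → MissingLowerBoundAt W 3)
    (hX3res : ∀ (W : WeierstrassCurve ℚ) [W.IsElliptic] [W.IsGloballyMinimal] [Fact (3 : ℕ).Prime],
      W.analyticRank = 0 → ClassO6 W 3 → ¬ Irr W 3 →
      (∀ (W' : WeierstrassCurve ℚ) [W'.IsElliptic] [W'.IsGloballyMinimal], IsIsogenous W W' →
        ∀ q' : ℚ, shaAn W' = (q' : ℂ) → 0 < padicValRat 3 q') → MissingLowerBoundAt W 3) :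
    WildLowerHalfRankZero := by
  intro W _ _ _ hr hO
  by_cases hunit : ∃ (W' : WeierstrassCurve ℚ) (_ : W'.IsElliptic) (_ : W'.IsGloballyMinimal),
      IsIsogenous W W' ∧ ∃ q' : ℚ, shaAn W' = (q' : ℂ) ∧ padicValRat 3 q' ≤ 0
  · obtain ⟨W', hW', hM', hiso, q', hq', hv'⟩ := hunit
    haveI := hW'
    haveI := hM'
    exact missingLowerBoundAt_wild_of_isIsogenous_unit hCassels hGZK hmod W hr hO W' hiso hq' hv'
  · have hnon : ∀ (W' : WeierstrassCurve ℚ) [W'.IsElliptic] [W'.IsGloballyMinimal], IsIsogenous W W' →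
        ∀ q' : ℚ, shaAn W' = (q' : ℂ) → 0 < padicValRat 3 q' :=
      fun W' hW' hM' hiso q' hq' ↦ lt_of_not_ge fun hv' ↦ hunit ⟨W', hW', hM', hiso, q', hq', hv'⟩
    by_cases hI : Irr W 3
    · by_cases hloc : LocIrr W 3 ∧ FWNonsplitRam W 3
      · exact missingLowerBoundAt_wild_of_fwClaim_of_readings hFW hR hreal hread hGZK hmod W hr hO hI
          hloc.1 hloc.2
      · exact hX4res W hr hO hI hloc hnon
    · exact hX3res W hr hO hI hnon

end Composition

end Summit.BirchSwinnertonDyer.BirchSwinnertonDyer.Theorems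

end
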